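import Literature.NumberTheory.Sieve.PolymathMkEpsCauchySchwarz
import Mathlib.MeasureTheory.Measure.Haar.NormedSpace
import Mathlib.MeasureTheory.Integral.IntegralEqImproper
import HarnessLib

/-!
# Polymath 8b, Theorem 3.12: dilation identities for the `ε`-enlarged functional and the chain
# `M_{k,ε'} ≤ ((1+ε')/(1+ε)) M_{k,ε}` (PROVED), plus the statement `M_{k,ε} ≤ M on [0, ε₁]`

D. H. J. Polymath, *Variants of the Selberg sieve, and bounded intervals containing many primes*,
Res. Math. Sci. 1:12 (2014) = arXiv:1407.4897, Theorem 3.12 and Remark 6.6, over the tree's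
`polymathFunctional k ε F = (∑ᵢ J_{i,1-ε}(F))/I(F)` and `IsPolymathTestFunction k ε F`
(`PolymathBoundedGaps.lean`). Everything up to `bound_of_eps_zero` is PROVED:

* `polymathI_comp_smul`, `polymathJ_comp_smul` — `I(F ∘ (c•)) = c^{-k} I(F)`,
  `J_{m,b}(F ∘ (c•)) = c^{-(k+1)} J_{m,cb}(F)` (`c > 0`);
* `polymathJ_mono_window` — `b ≤ b' ⇒ J_{m,b}(F) ≤ J_{m,b'}(F)` for a test function (needs the
  integrability of the squared fibre integral, `integrable_fibreSq`, by fibrewise Cauchy–Schwarz in `ℝ≥0∞`);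
* `dilationChain_holds : DilationChain` — for `0 ≤ ε ≤ ε' < 1` and an `ε'`-test function `F'`, the dilate
  `F' ∘ (λ•)`, `λ = (1+ε')/(1+ε)`, is an `ε`-test function and `functional(ε',F') ≤ λ · functional(ε, F'∘(λ•))`;
  consumers `chain_bound` (a class bound at `ε` transports to `ε'` with the factor `λ`), `chain_link` (one
  link of a grid covering) and `bound_of_eps_zero` (`M_{k,ε} ≤ (1+ε) M_{k,0}`-type transport, the limiting
  case `a → 1/(1+ε)` of Remark 6.6, p. 25).

The last section only NAMES the parametrised statement `EpsFunctionalLe k ε₁ M` ("`M_{k,ε} ≤ M` for all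
`0 ≤ ε ≤ ε₁`", test function by test function). Its closed instance `EpsFunctionalLe 3 (1/2) 2` — the cell
`k = 3` of the GEH side of Theorem 3.12 (ii) (`ε < 1/(k-1) = 1/2`, threshold `2m/θ = 2`); Polymath record
`1.91726 ≤ M_{3,ε}` (Remark 7.4, `ε = 56/113`) and do not decide whether `M_{3,ε} > 2` for some `ε < 1/2`
(they prove `GEH ⇒ H₁ ≤ 6` through the vanishing-marginal relaxation, Theorems 3.14/3.15, instead) — is
NOT in print and NOT proved here (the parity-ideate cell CERTIFIED it: 41 exact-rational Collatz–Wielandt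
instances of the tree's `polymathFunctional_le_of_weights` on the grid `ε = j/80`, chained by `chain_link`);
being an obligation of our theories rather than literature, it lives in
`Summits/Parity/GeneralizedHardyLittlewood/Theorems/EpsFunctionalThreeLeTwo.lean` as an `@[conjecture]`
leaf importing this file (rung leaf, D-0061).

Provenance: cell parity-ideate (planner seat p3, 2026-08-25), `evidence/Dilation.lean` (kernel-checked there,
standard axioms; refereed in the cell), landed unchanged up to tags/`private` markers by the cell's literature seat.

## References
* [Polymath8b2014] D. H. J. Polymath, *Variants of the Selberg sieve, and bounded intervals containing
  many primes*, Res. Math. Sci. 1 (2014), Art. 12 = arXiv:1407.4897: Theorem 3.12, Lemma 6.1,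
  Remark 6.6 (p. 25), Remark 7.4 (p. 31).
-/

noncomputable section

open MeasureTheory Set Finset
open scoped ENNReal BigOperators Pointwise

namespace Literature.NumberTheory.Sieve.MkEps


/-- `c • insertNth m u s = insertNth m (c u) (c • s)`. [folklore] -/
private theorem smul_insertNth {n : ℕ} (m : Fin (n + 1)) (c u : ℝ) (s : Fin n → ℝ) :
    c • Fin.insertNth m u s = Fin.insertNth m (c * u) (c • s) := by
  ext j
  refine Fin.succAboveCases m ?_ (fun i => ?_) j
  · simp [Fin.insertNth_apply_same]
  · simp [Fin.insertNth_apply_succAbove]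

/-- `c • (r·R_n) = (c r)·R_n` for `c > 0`. [folklore] -/
private theorem smul_scaledSimplex (n : ℕ) {c : ℝ} (hc : 0 < c) (r : ℝ) :
    c • scaledSimplex n r = scaledSimplex n (c * r) := by
  ext t
  rw [Set.mem_smul_set_iff_inv_smul_mem₀ hc.ne']
  simp only [scaledSimplex, Set.mem_setOf_eq, Pi.smul_apply, smul_eq_mul]
  constructor
  · rintro ⟨h1, h2⟩
    refine ⟨fun i => ?_, ?_⟩
    · have := h1 i
      rwa [mul_nonneg_iff_of_pos_left (inv_pos.2 hc)] at this
    · rw [← Finset.mul_sum] at h2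
      rw [inv_mul_le_iff₀ hc] at h2
      exact h2
  · rintro ⟨h1, h2⟩
    refine ⟨fun i => mul_nonneg (inv_pos.2 hc).le (h1 i), ?_⟩
    rw [← Finset.mul_sum, inv_mul_le_iff₀ hc]
    exact h2

/-- `c • [0,∞)^k = [0,∞)^k` for `c > 0`. [folklore] -/
private theorem smul_orthant (k : ℕ) {c : ℝ} (hc : 0 < c) :
    c • {t : Fin k → ℝ | ∀ i, 0 ≤ t i} = {t | ∀ i, 0 ≤ t i} := by
  ext t
  rw [Set.mem_smul_set_iff_inv_smul_mem₀ hc.ne']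
  simp only [Set.mem_setOf_eq, Pi.smul_apply, smul_eq_mul]
  exact forall_congr' fun i => mul_nonneg_iff_of_pos_left (inv_pos.2 hc)

/-- `I(F ∘ (c•)) = (c^k)⁻¹ I(F)` for `c > 0` (the rescaling step of §6). [cite: Polymath8b2014, §6 (proof of Theorem 3.10, "We first need to rescale", p. 20)] -/
theorem polymathI_comp_smul (k : ℕ) (F : (Fin k → ℝ) → ℝ) {c : ℝ} (hc : 0 < c) :
    polymathI k (fun t => F (c • t)) = (c ^ k)⁻¹ * polymathI k F := by
  unfold polymathI
  have h := Measure.setIntegral_comp_smul_of_pos (μ := (volume : Measure (Fin k → ℝ)))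
    (fun x => F x ^ 2) {t : Fin k → ℝ | ∀ i, 0 ≤ t i} hc
  simp only [Module.finrank_fintype_fun_eq_card, Fintype.card_fin, smul_eq_mul] at h
  rw [smul_orthant k hc] at h
  exact h

/-- `J_{m,b}(F ∘ (c•)) = (c^{n+2})⁻¹ J_{m,cb}(F)` on `Fin (n+1) → ℝ`, for `c > 0` (the rescaling step of §6). [cite: Polymath8b2014, §6 (proof of Theorem 3.12, "By truncating and rescaling", p. 21)] -/
theorem polymathJ_comp_smul {n : ℕ} (b : ℝ) (m : Fin (n + 1)) (F : (Fin (n + 1) → ℝ) → ℝ) {c : ℝ}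
    (hc : 0 < c) :
    polymathJ (n + 1) b m (fun t => F (c • t)) = (c ^ (n + 2))⁻¹ * polymathJ (n + 1) (c * b) m F := by
  rw [polymathJ_succ_eq, polymathJ_succ_eq]
  set φ : (Fin n → ℝ) → ℝ := fun s => ∫ u in Set.Ioi (0:ℝ), F (Fin.insertNth m u s) with hφ
  have hinner : ∀ s : Fin n → ℝ,
      (∫ u in Set.Ioi (0:ℝ), F (c • Fin.insertNth m u s)) = c⁻¹ * φ (c • s) := by
    intro s
    simp_rw [smul_insertNth]
    have h := integral_comp_mul_left_Ioi (fun v => F (Fin.insertNth m v (c • s))) 0 hc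
    simp only [mul_zero, smul_eq_mul] at h
    rw [h]
  simp_rw [hinner]
  have hsq : ∀ s : Fin n → ℝ, (c⁻¹ * φ (c • s)) ^ 2 = (c ^ 2)⁻¹ * (fun x => φ x ^ 2) (c • s) := by
    intro s; ring
  simp_rw [hsq]
  rw [integral_const_mul]
  have h := Measure.setIntegral_comp_smul_of_pos (μ := (volume : Measure (Fin n → ℝ)))
    (fun x => φ x ^ 2) (scaledSimplex n b) hc
  simp only [Module.finrank_fintype_fun_eq_card, Fintype.card_fin, smul_eq_mul] at h
  rw [smul_scaledSimplex n hc] at h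
  rw [h, ← mul_assoc]
  congr 1
  rw [← mul_inv, ← pow_add, add_comm]


/-! ### Window monotonicity: `b ≤ b' ⇒ J_{m,b}(F) ≤ J_{m,b'}(F)` for a test function -/

/-- The fibre-integral-squared function of a test function is integrable on the whole outer space
(`(∫_{u>0} F(ins u s) du)² ≤ (1+ε) ∫ F(ins u s)² du` fibrewise in `ℝ≥0∞`, then Tonelli — the
Cauchy–Schwarz step of §6 with constant weight). [cite: Polymath8b2014, Lemma 6.1 (Cauchy–Schwarz) and its proof, p. 24] -/
theorem integrable_fibreSq {n : ℕ} {ε : ℝ} (_hε : 0 ≤ 1 + ε) {F : (Fin (n + 1) → ℝ) → ℝ}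
    (hF : IsPolymathTestFunction (n + 1) ε F) (m : Fin (n + 1)) :
    Integrable (fun s : Fin n → ℝ => (∫ u in Set.Ioi (0:ℝ), F (Fin.insertNth m u s)) ^ 2) := by
  have hFm : Measurable F := hF.measurable
  -- joint measurability of `(u, s) ↦ F (ins u s)`
  set e := MeasurableEquiv.piFinSuccAbove (fun _ : Fin (n + 1) => ℝ) m with he_def
  have he : MeasurePreserving e.symm (volume.prod volume) volume := by
    have := (volume_preserving_piFinSuccAbove (fun _ : Fin (n + 1) => ℝ) m).symm
    rwa [Measure.volume_eq_prod] at this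
  have he_apply : ∀ p : ℝ × (Fin n → ℝ), e.symm p = Fin.insertNth m p.1 p.2 := fun p => by
    rw [he_def, MeasurableEquiv.piFinSuccAbove_symm_apply]; rfl
  have hins : Measurable fun p : ℝ × (Fin n → ℝ) => (Fin.insertNth m p.1 p.2 : Fin (n + 1) → ℝ) := by
    have : (fun p : ℝ × (Fin n → ℝ) => (Fin.insertNth m p.1 p.2 : Fin (n + 1) → ℝ)) = e.symm :=
      funext fun p => (he_apply p).symm
    rw [this]; exact e.symm.measurable
  have hG : Measurable fun p : ℝ × (Fin n → ℝ) => F (Fin.insertNth m p.1 p.2) := hFm.comp hins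
  -- strong measurability of the fibre integral
  have hφ : StronglyMeasurable fun s : Fin n → ℝ => ∫ u in Set.Ioi (0:ℝ), F (Fin.insertNth m u s) := by
    have h2 : StronglyMeasurable (Function.uncurry fun (s : Fin n → ℝ) (u : ℝ) => F (Fin.insertNth m u s)) :=
      (hG.comp measurable_swap).stronglyMeasurable
    exact h2.integral_prod_right (ν := volume.restrict (Set.Ioi (0:ℝ)))
  refine ⟨(hφ.measurable.pow_const 2).aestronglyMeasurable, ?_⟩
  -- finiteness via the fibrewise Cauchy–Schwarz bound in `ℝ≥0∞` and Tonelli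
  have hfib : ∀ s : Fin n → ℝ, ENNReal.ofReal ((∫ u in Set.Ioi (0:ℝ), F (Fin.insertNth m u s)) ^ 2) ≤
      ENNReal.ofReal (1 + ε) * ∫⁻ u, ENNReal.ofReal (F (Fin.insertNth m u s) ^ 2) := by
    intro s
    have hg : Measurable fun u : ℝ => F (Fin.insertNth m u s) :=
      hFm.comp (hins.comp (measurable_id.prodMk measurable_const))
    have h := MkEps.ofReal_sq_setIntegral_Ioi_le (g := fun u => F (Fin.insertNth m u s)) (w := fun _ => (1:ℝ))
      hg measurable_const (L := 1 + ε) (fun u hu hne => ?_)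
    · refine h.trans (mul_le_mul' ?_ ?_)
      · simp only [inv_one, ENNReal.ofReal_one, setLIntegral_const, one_mul, Real.volume_Ioc, sub_zero]
        exact le_rfl
      · exact (setLIntegral_le_lintegral _ _).trans (le_of_eq (by simp only [one_mul]))
    · have hmem : (Fin.insertNth m u s : Fin (n + 1) → ℝ) ∈ scaledSimplex (n + 1) (1 + ε) :=
        hF.support_subset (Function.mem_support.2 hne)
      obtain ⟨hs, -, hsum⟩ := (insertNth_mem_scaledSimplex_iff m (1 + ε) u s).1 hmem
      exact ⟨by linarith [Finset.sum_nonneg fun i (_ : i ∈ Finset.univ) => hs i], one_pos⟩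
  have htonelli : ∫⁻ s : Fin n → ℝ, ∫⁻ u, ENNReal.ofReal (F (Fin.insertNth m u s) ^ 2) =
      ∫⁻ t, ENNReal.ofReal (F t ^ 2) := by
    have hg2 : Measurable fun p : ℝ × (Fin n → ℝ) => ENNReal.ofReal (F (Fin.insertNth m p.1 p.2) ^ 2) :=
      (hG.pow_const 2).ennreal_ofReal
    have hsw : Measurable (Function.uncurry fun (s : Fin n → ℝ) (u : ℝ) =>
        ENNReal.ofReal (F (Fin.insertNth m u s) ^ 2)) := by
      change Measurable ((fun p : ℝ × (Fin n → ℝ) => ENNReal.ofReal (F (Fin.insertNth m p.1 p.2) ^ 2)) ∘ Prod.swap)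
      exact hg2.comp measurable_swap
    have h1 : ∫⁻ p : ℝ × (Fin n → ℝ), ENNReal.ofReal (F (Fin.insertNth m p.1 p.2) ^ 2) ∂(volume.prod volume) =
        ∫⁻ u : ℝ, ∫⁻ s : Fin n → ℝ, ENNReal.ofReal (F (Fin.insertNth m u s) ^ 2) :=
      lintegral_prod _ hg2.aemeasurable
    have h2 : ∫⁻ s : Fin n → ℝ, ∫⁻ u : ℝ, ENNReal.ofReal (F (Fin.insertNth m u s) ^ 2) =
        ∫⁻ u : ℝ, ∫⁻ s : Fin n → ℝ, ENNReal.ofReal (F (Fin.insertNth m u s) ^ 2) :=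
      lintegral_lintegral_swap hsw.aemeasurable
    have h3 : ∫⁻ p : ℝ × (Fin n → ℝ), ENNReal.ofReal (F (Fin.insertNth m p.1 p.2) ^ 2) ∂(volume.prod volume) =
        ∫⁻ t, ENNReal.ofReal (F t ^ 2) := by
      have := he.lintegral_comp (f := fun t => ENNReal.ofReal (F t ^ 2)) ((hFm.pow_const 2).ennreal_ofReal)
      simp_rw [he_apply] at this
      exact this
    rw [h2, ← h1, h3]
  have henorm : ∀ x : ℝ, ‖x ^ 2‖ₑ = ENNReal.ofReal (x ^ 2) := fun x => Real.enorm_eq_ofReal (sq_nonneg _)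
  have hfin : ∫⁻ t, ENNReal.ofReal (F t ^ 2) < ⊤ := by
    have h := hF.integrable_sq.hasFiniteIntegral
    unfold HasFiniteIntegral at h
    simp_rw [henorm] at h
    exact h
  unfold HasFiniteIntegral
  calc ∫⁻ s : Fin n → ℝ, ‖(∫ u in Set.Ioi (0:ℝ), F (Fin.insertNth m u s)) ^ 2‖ₑ
      = ∫⁻ s : Fin n → ℝ, ENNReal.ofReal ((∫ u in Set.Ioi (0:ℝ), F (Fin.insertNth m u s)) ^ 2) :=
        lintegral_congr fun s => henorm _
    _ ≤ ∫⁻ s : Fin n → ℝ, ENNReal.ofReal (1 + ε) * ∫⁻ u, ENNReal.ofReal (F (Fin.insertNth m u s) ^ 2) :=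
        lintegral_mono hfib
    _ = ENNReal.ofReal (1 + ε) * ∫⁻ t, ENNReal.ofReal (F t ^ 2) := by
        rw [lintegral_const_mul' _ _ ENNReal.ofReal_ne_top, htonelli]
    _ < ⊤ := ENNReal.mul_lt_top ENNReal.ofReal_lt_top hfin

/-- **Window monotonicity.** For a test function, `b ≤ b' ⇒ J_{m,b}(F) ≤ J_{m,b'}(F)` (the integrand `(∫F)²` is nonnegative). [cite: Polymath8b2014, Theorem 3.12 (definition of J_{i,1-ε})] -/
theorem polymathJ_mono_window {n : ℕ} {ε : ℝ} (hε : 0 ≤ 1 + ε) {F : (Fin (n + 1) → ℝ) → ℝ}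
    (hF : IsPolymathTestFunction (n + 1) ε F) (m : Fin (n + 1)) {b b' : ℝ} (hbb' : b ≤ b') :
    polymathJ (n + 1) b m F ≤ polymathJ (n + 1) b' m F := by
  rw [polymathJ_succ_eq, polymathJ_succ_eq]
  refine setIntegral_mono_set (integrable_fibreSq hε hF m).integrableOn
    (ae_of_all _ fun s => sq_nonneg _) (LE.le.eventuallyLE (show _ ≤ _ from fun s hs => ?_))
  exact ⟨hs.1, hs.2.trans hbb'⟩


/-! ### The chain `ε ≤ ε' ⇒ M_{k,ε'} ≤ ((1+ε')/(1+ε)) M_{k,ε}` -/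

/-- **The dilation chain** `ε ≤ ε' ⇒ M_{k,ε'} ≤ ((1+ε')/(1+ε))·M_{k,ε}`, test function by test function: the dilate
`F' ∘ (λ•)`, `λ = (1+ε')/(1+ε)`, of an `ε'`-test function is an `ε`-test function and
`functional(ε', F') ≤ λ · functional(ε, F' ∘ (λ•))` (`I` scales by `λ^{-k}`, each `J_{m,·}` by `λ^{-(k+1)}`,
and the window `1-ε' ≤ λ(1-ε)`). The limiting case `ε = 0` is Polymath 8b Remark 6.6
(`M_{k,ε} ≤ (1+ε) M_k`); the chaining device for `0 < ε ≤ ε'` is not in print (cell parity-ideate-p3, ROUND-1 §D.1). [cite: Polymath8b2014, Remark 6.6] -/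
def DilationChain : Prop :=
  ∀ ⦃k : ℕ⦄ ⦃ε ε' : ℝ⦄, 0 ≤ ε → ε ≤ ε' → ε' < 1 → ∀ ⦃F' : (Fin k → ℝ) → ℝ⦄, IsPolymathTestFunction k ε' F' →
    IsPolymathTestFunction k ε (fun t => F' (((1 + ε') / (1 + ε)) • t)) ∧
      polymathFunctional k ε' F' ≤
        (1 + ε') / (1 + ε) * polymathFunctional k ε (fun t => F' (((1 + ε') / (1 + ε)) • t))

/-- The dilate of an `ε'`-test function by `c ≥ (1+ε')/(1+ε)`… here exactly `c = (1+ε')/(1+ε)`, is an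
`ε`-test function. [cite: Polymath8b2014, Remark 6.6] -/
theorem isPolymathTestFunction_dilate {k : ℕ} {ε ε' : ℝ} (h0 : 0 ≤ ε) (h : ε ≤ ε')
    {F' : (Fin k → ℝ) → ℝ} (hF' : IsPolymathTestFunction k ε' F') :
    IsPolymathTestFunction k ε (fun t => F' (((1 + ε') / (1 + ε)) • t)) := by
  set c : ℝ := (1 + ε') / (1 + ε) with hc_def
  have hc : 0 < c := div_pos (by linarith) (by linarith)
  refine ⟨hF'.measurable.comp (measurable_const_smul c), fun t ht => ?_, ?_, ?_⟩
  · have hmem : c • t ∈ scaledSimplex k (1 + ε') := hF'.support_subset ht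
    simp only [scaledSimplex, Set.mem_setOf_eq, Pi.smul_apply, smul_eq_mul] at hmem ⊢
    obtain ⟨h1, h2⟩ := hmem
    refine ⟨fun i => (mul_nonneg_iff_of_pos_left hc).1 (h1 i), ?_⟩
    rw [← Finset.mul_sum] at h2
    have h1e : (0:ℝ) < 1 + ε := by linarith
    have : c * ∑ i, t i ≤ c * (1 + ε) := by
      rw [hc_def, div_mul_cancel₀ _ h1e.ne']; exact h2
    exact le_of_mul_le_mul_left this hc
  · exact (hF'.integrable_sq.comp_smul hc.ne').integrableOn
  · rw [polymathI_comp_smul k F' hc]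
    exact mul_pos (inv_pos.2 (pow_pos hc k)) hF'.polymathI_pos

/-- **The dilation chain holds.** [cite: Polymath8b2014, Remark 6.6] -/
theorem dilationChain_holds : DilationChain := by
  intro k ε ε' h0 h h1 F' hF'
  refine ⟨isPolymathTestFunction_dilate h0 h hF', ?_⟩
  set c : ℝ := (1 + ε') / (1 + ε) with hc_def
  have hc : 0 < c := div_pos (by linarith) (by linarith)
  have hG := isPolymathTestFunction_dilate h0 h hF'
  obtain _ | n := k
  · -- `k = 0`: both functionals vanish (empty sums)
    simp [polymathFunctional]
  have hI : polymathI (n + 1) (fun t => F' (c • t)) = (c ^ (n + 1))⁻¹ * polymathI (n + 1) F' :=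
    polymathI_comp_smul _ F' hc
  have hJ : ∀ m : Fin (n + 1), polymathJ (n + 1) (1 - ε) m (fun t => F' (c • t)) =
      (c ^ (n + 2))⁻¹ * polymathJ (n + 1) (c * (1 - ε)) m F' := fun m => polymathJ_comp_smul _ m F' hc
  have hwin : 1 - ε' ≤ c * (1 - ε) := by
    rw [hc_def, div_mul_eq_mul_div, le_div_iff₀ (by linarith)]
    nlinarith
  have hε'1 : (0:ℝ) ≤ 1 + ε' := by linarith
  have hmono : ∀ m : Fin (n + 1), polymathJ (n + 1) (1 - ε') m F' ≤ polymathJ (n + 1) (c * (1 - ε)) m F' :=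
    fun m => polymathJ_mono_window hε'1 hF' m hwin
  have hIpos := hF'.polymathI_pos
  have heq : c * polymathFunctional (n + 1) ε (fun t => F' (c • t)) =
      (∑ m, polymathJ (n + 1) (c * (1 - ε)) m F') / polymathI (n + 1) F' := by
    unfold polymathFunctional
    rw [hI]
    simp_rw [hJ]
    rw [← Finset.mul_sum]
    field_simp
    ring
  calc polymathFunctional (n + 1) ε' F'
      = (∑ m, polymathJ (n + 1) (1 - ε') m F') / polymathI (n + 1) F' := rfl
    _ ≤ (∑ m, polymathJ (n + 1) (c * (1 - ε)) m F') / polymathI (n + 1) F' :=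
        div_le_div_of_nonneg_right (Finset.sum_le_sum fun m _ => hmono m) hIpos.le
    _ = c * polymathFunctional (n + 1) ε (fun t => F' (c • t)) := heq.symm

/-- Consumer 1: a class bound at `ε` transports to `ε' ≥ ε` with the factor `(1+ε')/(1+ε)`. [cite: Polymath8b2014, Remark 6.6] -/
theorem chain_bound {k : ℕ} {ε ε' M : ℝ} (h0 : 0 ≤ ε) (h : ε ≤ ε') (h1 : ε' < 1)
    (hM : ∀ ⦃F : (Fin k → ℝ) → ℝ⦄, IsPolymathTestFunction k ε F → polymathFunctional k ε F ≤ M)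
    ⦃F' : (Fin k → ℝ) → ℝ⦄ (hF' : IsPolymathTestFunction k ε' F') :
    polymathFunctional k ε' F' ≤ (1 + ε') / (1 + ε) * M := by
  obtain ⟨hF, hle⟩ := dilationChain_holds h0 h h1 hF'
  have hl : 0 ≤ (1 + ε') / (1 + ε) := div_nonneg (by linarith) (by linarith)
  exact hle.trans (mul_le_mul_of_nonneg_left (hM hF) hl)

/-- Consumer 2 (one link of the certified covering of §D.3): a certificate `c` for the `a`-class with
`((1+b)/(1+a))·c ≤ 2` bounds the functional by `2` on every class `ε ∈ [a, b]`. [cite: Polymath8b2014, Remark 6.6] -/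
theorem chain_link {k : ℕ} {a b c : ℝ} (ha : 0 ≤ a) (hb : b < 1)
    (hcert : ∀ ⦃F : (Fin k → ℝ) → ℝ⦄, IsPolymathTestFunction k a F → polymathFunctional k a F ≤ c)
    (hprod : (1 + b) / (1 + a) * c ≤ 2) (hc : 0 ≤ c) ⦃ε : ℝ⦄ (hε : a ≤ ε) (hεb : ε ≤ b)
    ⦃F : (Fin k → ℝ) → ℝ⦄ (hF : IsPolymathTestFunction k ε F) : polymathFunctional k ε F ≤ 2 := by
  have h1 : polymathFunctional k ε F ≤ (1 + ε) / (1 + a) * c := chain_bound ha hε (by linarith) hcert hF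
  have h2 : (1 + ε) / (1 + a) * c ≤ (1 + b) / (1 + a) * c :=
    mul_le_mul_of_nonneg_right (div_le_div_of_nonneg_right (by linarith) (by linarith)) hc
  linarith

/-- Consumer 3 (the base of the covering, Polymath 8b Remark 6.6 limiting case): `M_{k,ε} ≤ (1+ε)·M_{k,0}`-type
transport from `ε = 0`: a class bound `M₀` at `ε = 0` gives `(1+ε) M₀` at every `ε ∈ [0,1)`. [cite: Polymath8b2014, Remark 6.6] -/
theorem bound_of_eps_zero {k : ℕ} {ε M₀ : ℝ} (h0 : 0 ≤ ε) (h1 : ε < 1)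
    (hM : ∀ ⦃F : (Fin k → ℝ) → ℝ⦄, IsPolymathTestFunction k 0 F → polymathFunctional k 0 F ≤ M₀)
    ⦃F : (Fin k → ℝ) → ℝ⦄ (hF : IsPolymathTestFunction k ε F) : polymathFunctional k ε F ≤ (1 + ε) * M₀ := by
  have := chain_bound (ε := 0) (ε' := ε) le_rfl h0 h1 hM hF
  simpa using this

/-! ### The statement `M_{k,ε} ≤ M` on an `ε`-range (parametrised; closed instances live under Summits/…/Theorems) -/

/-- **`M_{k,ε} ≤ M` for every `ε ∈ [0, ε₁]`**, test function by test function: for `0 ≤ ε ≤ ε₁` and every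
`F` of the class of Theorem 3.12 on `(1+ε)·R_k`, `(∑ᵢ J_{i,1-ε}(F))/I(F) ≤ M`. (For `M = 2m/θ` this says the
criterion of Theorem 3.12 with parameters `(k, m, θ)` is met by no test function at any `ε ≤ ε₁`.)
[cite: Polymath8b2014, Theorem 3.12] -/
def EpsFunctionalLe (k : ℕ) (ε₁ M : ℝ) : Prop :=
  ∀ ⦃ε : ℝ⦄, 0 ≤ ε → ε ≤ ε₁ → ∀ ⦃F : (Fin k → ℝ) → ℝ⦄,
    IsPolymathTestFunction k ε F → polymathFunctional k ε F ≤ M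

/-- Monotonicity in the range and the bound. [cite: Polymath8b2014, Theorem 3.12] -/
theorem EpsFunctionalLe.mono {k : ℕ} {ε₁ ε₁' M M' : ℝ} (hε : ε₁' ≤ ε₁) (hM : M ≤ M')
    (h : EpsFunctionalLe k ε₁ M) : EpsFunctionalLe k ε₁' M' :=
  fun _ε h0 h1 _F hF => (h h0 (h1.trans hε) hF).trans hM

end Literature.NumberTheory.Sieve.MkEps
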